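import Summits.CriticalPhenomena.PercolationContinuityZ3.Theorems.PercNearOneGluingNoHeavyLowerTailHullThreeEvents
import Summits.CriticalPhenomena.PercolationContinuityZ3.Theorems.PercNearOneGluingNoHeavyLowerTailHullThreeWorld
import Summits.CriticalPhenomena.PercolationContinuityZ3.Theorems.PercNearOneGluingNoHeavyLowerTailIsolationExchange
import Summits.CriticalPhenomena.PercolationContinuityZ3.Theorems.PercNearOneGluingNoHeavyLowerTailSeparationHarris
import Literature.Probability.Percolation.HierarchicalPercolation
import Literature.Probability.Percolation.LonelyClusterExchange
import HarnessLib

/-!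
# `NoHeavyLowerTail` (stmt-CriticalPhenomena-4575) — hull-port line, THREE PORTS: sign inputs on the inner law and the multipliers

Hull-port prover #4 (`prim-hp-4`, LP-duality technique), generation 2; `--supports stmt-CriticalPhenomena-4575`.  No sorries, no named
facts; the `def`s are the inner weights, the explicit multipliers of the certificate, and the port-separation event.  Layers used:
`…HullThreeCertificate` (constants `cst p…`, relations `E1 … E4`, residual coefficients `k01, k02`), `…HullThreeJoin`, `…HullThreeEvents`
(inner law `xlaw`); the assembly is `…CILThreePorts`.  For a three-port hull `X : Hull3 n` (best port `p 0`):
* SIGN INPUTS on the inner law (`inner_Q1`, `inner_Q2`, `inner_Q3`): the three instances of van den Berg–Häggström–Kahn's two-set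
  exchange (tree: `IsolationExchange.separation_harris`, `IsolationExchange.isolation_exchange`) on the INNER measure
  `prodBernoulli (w·1_F)` (`prodBernoulli_map_inter`), rewritten as inequalities among the constants `cst p… xlaw`.
* CERTIFICATE I (generic inner law): polynomial multipliers `θI = Dm·i0, ΛI, α1I, α2I, α12I` with `E1 = … = E4 = 0` (`certI_*`);
  their signs and the degenerate certificate II (`s1 = s2 = 0`) are handled in `…CILThreePorts`.
* `sepEv`, `cst_pD_eq`, `sep_pos_of_lt_one`: the port-separation event, its probability `d = cst pD xlaw`, positivity.
[cite: VandenbergHaggstromKahn2005, Thm. 1.5 — the only probabilistic input beyond independence]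
-/

noncomputable section

namespace Summit.CriticalPhenomena.PercolationContinuityZ3.Theorems

open MeasureTheory Set Literature.Probability.LatticeModels Literature.Probability.Percolation
open scoped Classical BigOperators

variable {n : ℕ}

namespace HullThree

namespace Hull3

variable {X : Hull3 n} {A : Finset (Fin n)} {j : ℕ}

/-! ### The inner measure -/

/-- The inner weights: `w` on the inner pairs, `0` elsewhere. -/
abbrev win (X : Hull3 n) : Sym2 (Fin n) → unitInterval := fun e => if e ∈ (↑X.F : Set (Sym2 (Fin n))) then X.w e else 0

/-- The inner law is the law of the pattern cell under the inner measure. -/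
theorem xlaw_eq_inner (b : IB) : X.xlaw b = (prodBernoulli (win X)).real (X.cell b) := by
  have hpre : X.cell b = (fun ξ : BondConfig (Fin n) => ξ ∩ ↑X.F) ⁻¹' X.cell b := by
    ext ω
    simp only [cell, mem_preimage, mem_setOf_eq]
    rw [ibits_congr (X := X) (ω := ω ∩ ↑X.F) (ω' := ω) (by rw [inter_assoc, inter_self])]
  rw [xlaw, ← prodBernoulli_map_inter X.w (↑X.F : Set (Sym2 (Fin n))), measureReal_def, measureReal_def,
    Measure.map_apply (Measurable.of_discrete) MeasurableSet.of_discrete, ← hpre]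

/-- On the support of the inner measure the configuration is inner, so the inner graph is the whole open graph. -/
theorem Gin_eq_of_supp {ξ : BondConfig (Fin n)} (hξ : ∀ e ∈ ξ, win X e ≠ 0) : X.Gin ξ = openGraph ξ := by
  have : ξ ∩ ↑X.F = ξ := by
    refine inter_eq_left.2 fun e he => ?_
    have := hξ e he
    by_contra h
    exact this (by simp [win, h])
  rw [Gin, this]

/-- **Inner probabilities of bit events.**  If on the inner support `ξ ∈ E ↔ P (ibits ξ)`, then `μ_in(E) = cst P xlaw`. -/
theorem inner_real_eq_cst (P : IB → Bool) (E : Set (BondConfig (Fin n)))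
    (hE : ∀ ξ : BondConfig (Fin n), (∀ e ∈ ξ, win X e ≠ 0) → (ξ ∈ E ↔ P (X.ibits ξ) = true)) :
    (prodBernoulli (win X)).real E = cst P X.xlaw := by
  rw [real_eq_sum_cells (win X) E, cst]
  refine Finset.sum_congr rfl fun b _ => ?_
  rw [← CutObserver.measureReal_inter_support (win X) (E ∩ X.cell b)]
  by_cases hb : P b = true
  · rw [if_pos hb, xlaw_eq_inner, ← CutObserver.measureReal_inter_support (win X) (X.cell b)]
    congr 1
    ext ξ
    simp only [mem_inter_iff, cell, mem_setOf_eq]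
    constructor
    · rintro ⟨⟨-, h1⟩, h2⟩; exact ⟨h1, h2⟩
    · rintro ⟨h1, h2⟩; exact ⟨⟨(hE ξ h2).2 (h1 ▸ hb), h1⟩, h2⟩
  · rw [if_neg hb]
    have : E ∩ X.cell b ∩ {ω | ∀ e ∈ ω, win X e ≠ 0} = ∅ := by
      ext ξ
      simp only [mem_inter_iff, cell, mem_setOf_eq, mem_empty_iff_false, iff_false]
      rintro ⟨⟨h0, h1⟩, h2⟩
      exact hb (h1 ▸ (hE ξ h2).1 h0)
    rw [this, measureReal_empty]

/-! ### Reading reachability among named points off the bits -/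

section bits

variable (ξ : BondConfig (Fin n))

/-- `o ↔ p 0` inside iff the bit `o0`. -/
theorem o0_iff : (X.Gin ξ).Reachable X.o (X.p 0) ↔ (X.ibits ξ).o0 = true := by simp [ibits, ir, vtx]
/-- `o ↔ p 1` inside iff the bit `o1`. -/
theorem o1_iff : (X.Gin ξ).Reachable X.o (X.p 1) ↔ (X.ibits ξ).o1 = true := by simp [ibits, ir, vtx]
/-- `o ↔ p 2` inside iff the bit `o2`. -/
theorem o2_iff : (X.Gin ξ).Reachable X.o (X.p 2) ↔ (X.ibits ξ).o2 = true := by simp [ibits, ir, vtx]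
/-- `p 1 ↔ o` inside iff the bit `o1`. -/
theorem o1_iff' : (X.Gin ξ).Reachable (X.p 1) X.o ↔ (X.ibits ξ).o1 = true :=
  by rw [SimpleGraph.reachable_comm, o1_iff]
/-- `p 2 ↔ o` inside iff the bit `o2`. -/
theorem o2_iff' : (X.Gin ξ).Reachable (X.p 2) X.o ↔ (X.ibits ξ).o2 = true :=
  by rw [SimpleGraph.reachable_comm, o2_iff]
/-- `p 0 ↔ p 1` inside iff the bit `p01`. -/
theorem p01_iff : (X.Gin ξ).Reachable (X.p 0) (X.p 1) ↔ (X.ibits ξ).p01 = true := by simp [ibits, ir, vtx]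
/-- `p 0 ↔ p 2` inside iff the bit `p02`. -/
theorem p02_iff : (X.Gin ξ).Reachable (X.p 0) (X.p 2) ↔ (X.ibits ξ).p02 = true := by simp [ibits, ir, vtx]
/-- `p 1 ↔ p 2` inside iff the bit `p12`. -/
theorem p12_iff : (X.Gin ξ).Reachable (X.p 1) (X.p 2) ↔ (X.ibits ξ).p12 = true := by simp [ibits, ir, vtx]
/-- `p 1 ↔ p 0` inside iff the bit `p01`. -/
theorem p10_iff : (X.Gin ξ).Reachable (X.p 1) (X.p 0) ↔ (X.ibits ξ).p01 = true :=
  by rw [SimpleGraph.reachable_comm, p01_iff]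
/-- `p 2 ↔ p 0` inside iff the bit `p02`. -/
theorem p20_iff : (X.Gin ξ).Reachable (X.p 2) (X.p 0) ↔ (X.ibits ξ).p02 = true :=
  by rw [SimpleGraph.reachable_comm, p02_iff]
/-- `p 2 ↔ p 1` inside iff the bit `p12`. -/
theorem p21_iff : (X.Gin ξ).Reachable (X.p 2) (X.p 1) ↔ (X.ibits ξ).p12 = true :=
  by rw [SimpleGraph.reachable_comm, p12_iff]

end bits

/-- Bit descriptions of the named constants (kernel decision on closed patterns). -/
theorem bits_table : ∀ b : IB, b.closed = true →
    ((pI2 b = true ↔ b.p02 = false ∧ b.p12 = false) ∧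
     (pA2p b = true ↔ b.p02 = false ∧ b.p12 = false ∧ b.o2 = true ∧ b.p01 = true) ∧
     (pS2 b = true ↔ b.p02 = false ∧ b.p12 = false ∧ b.o2 = true) ∧
     (pG01 b = true ↔ b.p02 = false ∧ b.p12 = false ∧ b.p01 = true) ∧
     (pI1 b = true ↔ b.p01 = false ∧ b.p12 = false) ∧
     (pA1p b = true ↔ b.p01 = false ∧ b.p12 = false ∧ b.o1 = true ∧ b.p02 = true) ∧
     (pS1 b = true ↔ b.p01 = false ∧ b.p12 = false ∧ b.o1 = true) ∧
     (pG02 b = true ↔ b.p01 = false ∧ b.p12 = false ∧ b.p02 = true) ∧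
     (pI0 b = true ↔ b.p01 = false ∧ b.p02 = false) ∧
     ((pA1 b || pA2 b || pA12 b) = true ↔ b.p01 = false ∧ b.p02 = false ∧ (b.o1 = true ∨ b.o2 = true)) ∧
     (pG12 b = true ↔ b.p01 = false ∧ b.p02 = false ∧ b.p12 = true) ∧
     (pA12 b = true ↔ b.p01 = false ∧ b.p02 = false ∧ (b.o1 = true ∨ b.o2 = true) ∧ b.p12 = true) ∧
     (pD b = true ↔ b.p01 = false ∧ b.p02 = false ∧ b.p12 = false)) := by
  decide +kernel

/-- The three named constants `a1, a2, a12` are carried by disjoint patterns. -/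
theorem iota_or_three : ∀ b : IB,
    ι ((pA1 b || pA2 b || pA12 b) = true) = ι (pA1 b = true) + ι (pA2 b = true) + ι (pA12 b = true) := by
  decide +kernel

/-- `cst (pA1 ∨ pA2 ∨ pA12) = a1 + a2 + a12`. -/
theorem cst_or_three (x : IB → ℝ) :
    cst (fun b => pA1 b || pA2 b || pA12 b) x = cst pA1 x + cst pA2 x + cst pA12 x := by
  simp only [cst_eq_sum, ← Finset.sum_add_distrib]
  refine Finset.sum_congr rfl fun b _ => ?_
  rw [← mul_add, ← mul_add]
  congr 1
  exact_mod_cast iota_or_three b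

/-! ### The three sign inputs on the inner law -/

section signs

variable (X A)

/-- (Q2) `a2p · i2 ≤ s2 · g01`: given that `p 2` is inner-separated from `p 0, p 1`, the events `{p 2 ↔ o}` and `{p 0 ↔ p 1}` are
negatively correlated (BHK Thm 1.5, `isolation_exchange` on the inner measure). -/
theorem inner_Q2 : cst pA2p X.xlaw * cst pI2 X.xlaw ≤ cst pS2 X.xlaw * cst pG01 X.xlaw := by
  have key := IsolationExchange.isolation_exchange (win X) ({X.p 2} : Set (Fin n)) ({X.p 0, X.p 1} : Set (Fin n))
    (s₀ := X.p 2) (t₀ := X.p 0) rfl (mem_insert _ _) X.o (X.p 1)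
  have hD : ∀ ξ : BondConfig (Fin n), (∀ e ∈ ξ, win X e ≠ 0) →
      (ξ ∈ {ω : BondConfig (Fin n) | ∀ s ∈ ({X.p 2} : Set (Fin n)), ∀ t ∈ ({X.p 0, X.p 1} : Set (Fin n)),
        ¬ (openGraph ω).Reachable s t} ↔ (X.ibits ξ).p02 = false ∧ (X.ibits ξ).p12 = false) := by
    intro ξ hξ
    simp only [mem_setOf_eq, mem_singleton_iff, mem_insert_iff, forall_eq_or_imp, forall_eq, ← Gin_eq_of_supp hξ,
      ← Bool.not_eq_true, p20_iff, p21_iff]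
  rw [inner_real_eq_cst pA2p, inner_real_eq_cst pI2, inner_real_eq_cst pS2, inner_real_eq_cst pG01] at key
  · exact key
  · intro ξ hξ
    rw [(bits_table _ (closed_ibits ξ)).2.2.2.1, mem_inter_iff, hD ξ hξ]
    simp only [openConn, mem_setOf_eq, ← Gin_eq_of_supp hξ, p01_iff, and_assoc]
  · intro ξ hξ
    rw [(bits_table _ (closed_ibits ξ)).2.2.1, mem_inter_iff, hD ξ hξ]
    simp only [openConn, mem_setOf_eq, ← Gin_eq_of_supp hξ, o2_iff', and_assoc]
  · intro ξ hξ
    rw [(bits_table _ (closed_ibits ξ)).1, hD ξ hξ]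
  · intro ξ hξ
    rw [(bits_table _ (closed_ibits ξ)).2.1, mem_inter_iff, hD ξ hξ, mem_inter_iff]
    simp only [openConn, mem_setOf_eq, ← Gin_eq_of_supp hξ, o2_iff', p01_iff, and_assoc]

/-- (Q3) `a1p · i1 ≤ s1 · g02` (the same exchange with the roles of `p 1`, `p 2` swapped). -/
theorem inner_Q3 : cst pA1p X.xlaw * cst pI1 X.xlaw ≤ cst pS1 X.xlaw * cst pG02 X.xlaw := by
  have key := IsolationExchange.isolation_exchange (win X) ({X.p 1} : Set (Fin n)) ({X.p 0, X.p 2} : Set (Fin n))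
    (s₀ := X.p 1) (t₀ := X.p 0) rfl (mem_insert _ _) X.o (X.p 2)
  have hD : ∀ ξ : BondConfig (Fin n), (∀ e ∈ ξ, win X e ≠ 0) →
      (ξ ∈ {ω : BondConfig (Fin n) | ∀ s ∈ ({X.p 1} : Set (Fin n)), ∀ t ∈ ({X.p 0, X.p 2} : Set (Fin n)),
        ¬ (openGraph ω).Reachable s t} ↔ (X.ibits ξ).p01 = false ∧ (X.ibits ξ).p12 = false) := by
    intro ξ hξ
    simp only [mem_setOf_eq, mem_singleton_iff, mem_insert_iff, forall_eq_or_imp, forall_eq, ← Gin_eq_of_supp hξ,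
      ← Bool.not_eq_true, p10_iff, p12_iff]
  rw [inner_real_eq_cst pA1p, inner_real_eq_cst pI1, inner_real_eq_cst pS1, inner_real_eq_cst pG02] at key
  · exact key
  · intro ξ hξ
    rw [(bits_table _ (closed_ibits ξ)).2.2.2.2.2.2.2.1, mem_inter_iff, hD ξ hξ]
    simp only [openConn, mem_setOf_eq, ← Gin_eq_of_supp hξ, p02_iff, and_assoc]
  · intro ξ hξ
    rw [(bits_table _ (closed_ibits ξ)).2.2.2.2.2.2.1, mem_inter_iff, hD ξ hξ]
    simp only [openConn, mem_setOf_eq, ← Gin_eq_of_supp hξ, o1_iff', and_assoc]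
  · intro ξ hξ
    rw [(bits_table _ (closed_ibits ξ)).2.2.2.2.1, hD ξ hξ]
  · intro ξ hξ
    rw [(bits_table _ (closed_ibits ξ)).2.2.2.2.2.1, mem_inter_iff, hD ξ hξ, mem_inter_iff]
    simp only [openConn, mem_setOf_eq, ← Gin_eq_of_supp hξ, o1_iff', p02_iff, and_assoc]

/-- (Q1) `(a1 + a2 + a12) · g12 ≤ i0 · a12`: given that `p 0` is inner-separated from `p 1, p 2`, the events `{o ↔ {p 1, p 2}}` and
`{p 1 ↔ p 2}` are positively correlated (BHK Thm 1.5 with two type-`(−)` events, `separation_harris` on the inner measure). -/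
theorem inner_Q1 :
    (cst pA1 X.xlaw + cst pA2 X.xlaw + cst pA12 X.xlaw) * cst pG12 X.xlaw ≤ cst pI0 X.xlaw * cst pA12 X.xlaw := by
  have key := IsolationExchange.separation_harris (win X) ({X.p 0} : Set (Fin n)) ({X.p 1, X.p 2} : Set (Fin n))
    (t₀ := X.p 1) (mem_insert _ _) X.o (X.p 2)
  have hD : ∀ ξ : BondConfig (Fin n), (∀ e ∈ ξ, win X e ≠ 0) →
      (ξ ∈ {ω : BondConfig (Fin n) | ∀ s ∈ ({X.p 0} : Set (Fin n)), ∀ t ∈ ({X.p 1, X.p 2} : Set (Fin n)),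
        ¬ (openGraph ω).Reachable s t} ↔ (X.ibits ξ).p01 = false ∧ (X.ibits ξ).p02 = false) := by
    intro ξ hξ
    simp only [mem_setOf_eq, mem_singleton_iff, mem_insert_iff, forall_eq_or_imp, forall_eq, ← Gin_eq_of_supp hξ,
      ← Bool.not_eq_true, p01_iff, p02_iff]
  have hU : ∀ ξ : BondConfig (Fin n), (∀ e ∈ ξ, win X e ≠ 0) →
      (ξ ∈ (⋃ t ∈ ({X.p 1, X.p 2} : Set (Fin n)), (openConn t X.o : Set (BondConfig (Fin n)))) ↔
        (X.ibits ξ).o1 = true ∨ (X.ibits ξ).o2 = true) := by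
    intro ξ hξ
    simp only [mem_iUnion, mem_insert_iff, mem_singleton_iff, exists_prop, exists_eq_or_imp, exists_eq_left, openConn,
      mem_setOf_eq, ← Gin_eq_of_supp hξ, o1_iff', o2_iff']
  rw [inner_real_eq_cst (fun b => pA1 b || pA2 b || pA12 b), inner_real_eq_cst pG12, inner_real_eq_cst pI0,
    inner_real_eq_cst pA12] at key
  · rw [← cst_or_three]; exact key
  · intro ξ hξ
    rw [(bits_table _ (closed_ibits ξ)).2.2.2.2.2.2.2.2.2.2.2.1, mem_inter_iff, hD ξ hξ, mem_inter_iff, hU ξ hξ]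
    simp only [openConn, mem_setOf_eq, ← Gin_eq_of_supp hξ, p12_iff, and_assoc]
  · intro ξ hξ
    rw [(bits_table _ (closed_ibits ξ)).2.2.2.2.2.2.2.2.1, hD ξ hξ]
  · intro ξ hξ
    rw [(bits_table _ (closed_ibits ξ)).2.2.2.2.2.2.2.2.2.2.1, mem_inter_iff, hD ξ hξ]
    simp only [openConn, mem_setOf_eq, ← Gin_eq_of_supp hξ, p12_iff, and_assoc]
  · intro ξ hξ
    rw [(bits_table _ (closed_ibits ξ)).2.2.2.2.2.2.2.2.2.1, mem_inter_iff, hD ξ hξ, hU ξ hξ, and_assoc]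

end signs

/-! ### Linear identities among the constants -/

/-- `i1 = d + g02` patternwise. -/
theorem iota_pI1 : ∀ b : IB, ι (pI1 b = true) = ι (pD b = true) + ι (pG02 b = true) := by decide +kernel
/-- `i2 = d + g01` patternwise. -/
theorem iota_pI2 : ∀ b : IB, ι (pI2 b = true) = ι (pD b = true) + ι (pG01 b = true) := by decide +kernel
/-- `i0 = d + g12` patternwise. -/
theorem iota_pI0 : ∀ b : IB, ι (pI0 b = true) = ι (pD b = true) + ι (pG12 b = true) := by decide +kernel
/-- `s1 = a1 + a1p` patternwise. -/
theorem iota_pS1 : ∀ b : IB, ι (pS1 b = true) = ι (pA1 b = true) + ι (pA1p b = true) := by decide +kernel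
/-- `s2 = a2 + a2p` patternwise. -/
theorem iota_pS2 : ∀ b : IB, ι (pS2 b = true) = ι (pA2 b = true) + ι (pA2p b = true) := by decide +kernel

/-- A patternwise identity of indicators gives an identity of constants. -/
theorem cst_split {P Q R : IB → Bool} (h : ∀ b : IB, ι (P b = true) = ι (Q b = true) + ι (R b = true)) (x : IB → ℝ) :
    cst P x = cst Q x + cst R x := by
  simp only [cst_eq_sum, ← Finset.sum_add_distrib]
  refine Finset.sum_congr rfl fun b _ => ?_
  rw [← mul_add]
  congr 1
  exact_mod_cast h b

/-- The constants are nonnegative. -/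
theorem cst_nonneg (P : IB → Bool) : 0 ≤ cst P X.xlaw :=
  Finset.sum_nonneg fun b _ => by split_ifs; exacts [xlaw_nonneg b, le_rfl]

/-! ### The multipliers of certificate I (generic case) -/

section mult

variable (x : IB → ℝ)

/-- `A = a1 + a2`. -/
def cA : ℝ := cst pA1 x + cst pA2 x
/-- `σ' = d·(s1·i2 + s2·i1)`. -/
def cσ : ℝ := cst pD x * (cst pS1 x * cst pI2 x + cst pS2 x * cst pI1 x)
/-- `θ = (2A·i1·i2 − σ')·i0` — the multiplier of the target `U`. -/
def θI : ℝ := (2 * cA x * cst pI1 x * cst pI2 x - cσ x) * cst pI0 x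
/-- `Λ = (A·i1·i2 − σ')·i0` — the multiplier of the shift rows. -/
def ΛI : ℝ := (cA x * cst pI1 x * cst pI2 x - cσ x) * cst pI0 x
/-- `α1 = A·s1·i2·i0`. -/
def α1I : ℝ := cA x * cst pS1 x * cst pI2 x * cst pI0 x
/-- `α2 = A·s2·i1·i0`. -/
def α2I : ℝ := cA x * cst pS2 x * cst pI1 x * cst pI0 x
/-- `α12 = (s1·i2 + s2·i1)·(d·a12 − A·g12)`. -/
def α12I : ℝ := (cst pS1 x * cst pI2 x + cst pS2 x * cst pI1 x) * (cst pD x * cst pA12 x - cA x * cst pG12 x)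

/-- Certificate I satisfies `E1 = 0` (uses `i0 = d + g12`). -/
theorem certI_E1 : E1 x (θI x) (ΛI x) (α1I x) (α2I x) (α12I x) = 0 := by
  unfold E1 θI ΛI α1I α2I α12I cσ cA
  rw [cst_split iota_pI0 x]
  ring

/-- Certificate I satisfies `E2 = 0`. -/
theorem certI_E2 : E2 x (θI x) (ΛI x) (α1I x) = 0 := by
  unfold E2 θI ΛI α1I cσ cA; ring

/-- Certificate I satisfies `E3 = 0`. -/
theorem certI_E3 : E3 x (θI x) (ΛI x) (α2I x) = 0 := by
  unfold E3 θI ΛI α2I cσ cA; ring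

/-- Certificate I satisfies `E4 = 0`. -/
theorem certI_E4 : E4 x (θI x) (ΛI x) (α1I x) (α2I x) (α12I x) = 0 := by
  unfold E4 θI ΛI α1I α2I α12I cσ cA; ring

/-- The residual coefficient `k01` of certificate I, factorised. -/
theorem certI_k01 : k01 x (θI x) (ΛI x) (α2I x) =
    cA x * cst pI1 x * cst pI0 x * (cst pS2 x * cst pG01 x - cst pA2p x * cst pI2 x) := by
  unfold k01 θI ΛI α2I cσ cA; ring

/-- The residual coefficient `k02` of certificate I, factorised. -/
theorem certI_k02 : k02 x (θI x) (ΛI x) (α1I x) =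
    cA x * cst pI2 x * cst pI0 x * (cst pS1 x * cst pG02 x - cst pA1p x * cst pI1 x) := by
  unfold k02 θI ΛI α1I cσ cA; ring

/-- The shift multiplier `Λ` of certificate I, rewritten with `i1 = d + g02`, `i2 = d + g01`, `s_b = a_b + a_bp`. -/
theorem certI_Λ : ΛI x = ((cst pA1 x * cst pG02 x - cst pD x * cst pA1p x) * cst pI2 x +
    (cst pA2 x * cst pG01 x - cst pD x * cst pA2p x) * cst pI1 x) * cst pI0 x := by
  unfold ΛI cσ cA
  rw [cst_split iota_pI1 x, cst_split iota_pI2 x, cst_split iota_pS1 x, cst_split iota_pS2 x]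
  ring

/-- `θ = Λ + A·i1·i2·i0`. -/
theorem certI_θ : θI x = ΛI x + cA x * cst pI1 x * cst pI2 x * cst pI0 x := by
  unfold θI ΛI; ring

end mult

/-! ### The port-separation event -/

/-- The ports are pairwise inner-separated. -/
def sepEv (X : Hull3 n) : Set (BondConfig (Fin n)) :=
  {ω | ∀ i k : Fin 3, i ≠ k → ¬ (X.Gin ω).Reachable (X.p i) (X.p k)}

/-- Membership in the separation event in terms of the port–port bits. -/
theorem mem_sepEv_iff (ω : BondConfig (Fin n)) :
    ω ∈ sepEv X ↔ (X.ibits ω).p01 = false ∧ (X.ibits ω).p02 = false ∧ (X.ibits ω).p12 = false := by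
  simp only [sepEv, mem_setOf_eq, ← Bool.not_eq_true, ← p01_iff, ← p02_iff, ← p12_iff]
  constructor
  · intro h
    exact ⟨h 0 1 (by decide), h 0 2 (by decide), h 1 2 (by decide)⟩
  · rintro ⟨h1, h2, h3⟩ i k hik
    fin_cases i <;> fin_cases k
    · exact absurd rfl hik
    · exact h1
    · exact h2
    · exact fun h => h1 h.symm
    · exact absurd rfl hik
    · exact h3
    · exact fun h => h2 h.symm
    · exact fun h => h3 h.symm
    · exact absurd rfl hik

/-- The separation event has the same probability under the inner measure. -/
theorem real_sepEv_eq_inner : (prodBernoulli X.w).real (sepEv X) = (prodBernoulli (win X)).real (sepEv X) := by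
  have hpre : sepEv X = (fun ξ : BondConfig (Fin n) => ξ ∩ ↑X.F) ⁻¹' sepEv X := by
    ext ω
    rw [mem_preimage, mem_sepEv_iff, mem_sepEv_iff,
      ibits_congr (X := X) (ω := ω ∩ ↑X.F) (ω' := ω) (by rw [inter_assoc, inter_self])]
  rw [← prodBernoulli_map_inter X.w (↑X.F : Set (Sym2 (Fin n))), measureReal_def, measureReal_def,
    Measure.map_apply (Measurable.of_discrete) MeasurableSet.of_discrete, ← hpre]

/-- `d = cst pD xlaw` is the probability that the ports are pairwise inner-separated. -/
theorem cst_pD_eq : cst pD X.xlaw = (prodBernoulli X.w).real (sepEv X) := by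
  rw [real_sepEv_eq_inner]
  symm
  refine inner_real_eq_cst pD (sepEv X) fun ξ _ => ?_
  rw [(bits_table _ (closed_ibits ξ)).2.2.2.2.2.2.2.2.2.2.2.2, mem_sepEv_iff]

/-- If every inner pair has weight `< 1`, the ports are pairwise inner-separated with positive probability. -/
theorem sep_pos_of_lt_one (hw : ∀ e ∈ X.F, X.w e < 1) : 0 < (prodBernoulli X.w).real (sepEv X) := by
  have hsub : {ω : BondConfig (Fin n) | ∀ e ∈ X.F, e ∉ ω} ⊆ sepEv X := by
    intro ω hω i k hik hr
    have hempty : ω ∩ ↑X.F = ∅ := by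
      ext e
      simp only [mem_inter_iff, Finset.mem_coe, mem_empty_iff_false, iff_false, not_and]
      exact fun he hF => hω e hF he
    have : (X.Gin ω) = ⊥ := by
      rw [Gin, hempty]
      ext u v
      simp
    rw [this] at hr
    exact X.hpinj.ne hik (SimpleGraph.reachable_bot.1 hr)
  refine lt_of_lt_of_le ?_ (measureReal_mono hsub (measure_ne_top _ _))
  rw [prodBernoulli_real_forall_notMem]
  exact Finset.prod_pos fun e he => by
    have := hw e he
    have h1 : ((X.w e : ℝ)) < 1 := this
    linarith

end Hull3

end HullThree

end Summit.CriticalPhenomena.PercolationContinuityZ3.Theorems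

end
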